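import Summits.BirchSwinnertonDyer.BirchSwinnertonDyer.Theorems.ResidualThetaTransportAtTwoLambdaLowerBoundOWeierstrass
import Summits.BirchSwinnertonDyer.BirchSwinnertonDyer.Theorems.ResidualThetaTransportAtTwoDefs
import HarnessLib

/-!
# W-d in `λ_𝒪`-currency: `lamO S (Λ_𝒪 ⧸ (Lm)) = d` for the norm-λ index `d` of `Lm ∈ Λ_𝒪 = IwasawaAlgebraO S`

Route `ResidualThetaTransportAtTwo` (RTT), crux RSL_g `ResidualSignedLambdaLowerCMAtTwo` (stmt-BirchSwinnertonDyer-22608), line «onepair»; LEAD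
`prover-bsd-wall-rtt-p2` g20 (`--supports 22608 --as helper`, closes nothing). THEOREMS ONLY (no definition, no named fact, no instance, no `sorry`).
BSD is not proved by any of this; RSL_g / KZ_g stay OPEN / HOLD.

This is station **(W-d) = I5** of the KZ_g interior (critic S139; k3-g24 node `ThetaTransport.S3BodyOfStations.s3body_sameClass_of_stations`,
hypothesis `hd : lamO S (IwasawaAlgebraO S ⧸ Ideal.span {Lm}) = d`): the crux's analytic exponent `d`, pinned in RSL_g / S3″ by the two norm
binders on `iwasawaOToPowerSeries S Lm` (`‖coeff k‖ ≤ ‖coeff d‖` for all `k`, `<` for `k < d`), IS the `λ_𝒪`-invariant of `Λ_𝒪 ⧸ (Lm)` in the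
`lamO` currency of `Theorems/ResidualThetaTransportAtTwoDefs` (`lamO S X = dim_{Frac 𝒪} (Frac 𝒪 ⊗_𝒪 X)`). The landed
`LambdaLowerBoundO.finrank_baseChange_quotient_span_eq_of_normLambda` states it for the base change to the FIELD `E` (`𝒪 = 𝒪_E`); here the same
argument is run for ANY field `K` into which `𝒪_E` embeds (§1), and then specialised to `K := FractionRing 𝒪` on the crux's carriers (§2).

* §1 `finrank_baseChange_quotient_span_eq_of_normLambda_field` — `dim_K (K ⊗_{𝒪_E} 𝒪_E⟦T⟧/(L)) = d` (`L = C(c)·L₀` by the landed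
  `exists_eq_C_mul_of_normLambda`, `𝒪⟦T⟧/(L₀)` free of rank `d` by `free_finrank_quotient_span_of_order_eq`, the kernel of
  `𝒪⟦T⟧/(L) ↠ 𝒪⟦T⟧/(L₀)` is killed by `c`, a unit in `K`; `finrank_baseChange_eq_of_surjective_of_smul_ker_eq_zero`).
* §2 `lamO_quotient_span_eq_of_normLambda_iwasawaAlgebraO` — `lamO S (IwasawaAlgebraO S ⧸ Ideal.span {Lm}) = d` under RSL_g's norm binders.

-- adapted from Cruxes/ResidualThetaCountLowerPureAtTwo/Sketch_sidea_k2_g19.lean §6a–§6b (stub-ideation k2 g19, kernel-checked there, not importable)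

References: [Washington1997] §7.1 Prop. 7.2 / Thm. 7.3 (Weierstrass preparation), §13.2; [Kato2004Asterisque] §13.8 (p. 228).
-/

set_option autoImplicit false
-- the Theorems namespace of this sub repeats the summit name by design (D-0017 nested layout)
set_option linter.dupNamespace false

noncomputable section

open scoped TensorProduct

namespace Summit.BirchSwinnertonDyer.BirchSwinnertonDyer.Theorems.LambdaLowerBoundO

universe u

/-! ### §1. `dim_K (K ⊗_{𝒪_E} 𝒪_E⟦T⟧/(L)) = d` for every field `K ⊇ 𝒪_E` -/

section UnitBall

open Literature.NumberTheory.Automorphic PowerSeries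

variable (p : ℕ) [Fact p.Prime] (E : IntermediateField ℚ_[p] (PadicAlgCl p)) [FiniteDimensional ℚ_[p] E]

/-- **`dim_K (K ⊗_{𝒪_E} 𝒪_E⟦T⟧/(L)) = d`** for every field `K` into which `𝒪_E` embeds: with `L = C(c)·L₀` (`c = coeff d L ≠ 0`,
`L₀` of order `d` mod `𝔪`), `𝒪⟦T⟧/(L₀)` is free of rank `d` and the kernel of `𝒪⟦T⟧/(L) ↠ 𝒪⟦T⟧/(L₀)` is killed by `c`, a unit of `K`.
Verbatim re-run of `finrank_baseChange_quotient_span_eq_of_normLambda` with the base field `E` replaced by `K`.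
[cite: Washington1997, §7.1 Thm. 7.3 and §13.2] -/
theorem finrank_baseChange_quotient_span_eq_of_normLambda_field (K : Type u) [Field K]
    [Algebra (PadicIntermediateField.unitBall p E) K]
    (hK : Function.Injective (algebraMap (PadicIntermediateField.unitBall p E) K))
    (L : PowerSeries (PadicIntermediateField.unitBall p E)) (d : ℕ) (hL : L ≠ 0)
    (hle : ∀ k, ‖((coeff k L : PadicIntermediateField.unitBall p E) : PadicAlgCl p)‖ ≤
      ‖((coeff d L : PadicIntermediateField.unitBall p E) : PadicAlgCl p)‖)
    (hlt : ∀ k, k < d → ‖((coeff k L : PadicIntermediateField.unitBall p E) : PadicAlgCl p)‖ <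
      ‖((coeff d L : PadicIntermediateField.unitBall p E) : PadicAlgCl p)‖) :
    Module.finrank K (K ⊗[PadicIntermediateField.unitBall p E]
      (PowerSeries (PadicIntermediateField.unitBall p E) ⧸ Ideal.span {L})) = d := by
  obtain ⟨L₀, hfac, hc0, hd1, hlow⟩ := exists_eq_C_mul_of_normLambda p E L d hL hle hlt
  set c := coeff d L with hc
  obtain ⟨hfree, hfin, hrank⟩ :=
    free_finrank_quotient_span_of_order_eq p E L₀ d (order_map_residue_eq L₀ d hd1 hlow)
  haveI := hfree
  haveI := hfin
  -- the surjection `Λ/(L) → Λ/(L₀)` and its `c`-torsion kernel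
  have hle' : Ideal.span {L} ≤ Ideal.span {L₀} := by
    rw [Ideal.span_singleton_le_span_singleton, hfac]
    exact Dvd.intro_left _ rfl
  let π : (PowerSeries (PadicIntermediateField.unitBall p E) ⧸ Ideal.span {L}) →ₐ[
      PadicIntermediateField.unitBall p E]
      (PowerSeries (PadicIntermediateField.unitBall p E) ⧸ Ideal.span {L₀}) :=
    Ideal.Quotient.factorₐ (PadicIntermediateField.unitBall p E) hle'
  have hπ : Function.Surjective π.toLinearMap := Ideal.Quotient.factor_surjective hle'
  have hker : ∀ x ∈ LinearMap.ker π.toLinearMap, c • x = 0 := by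
    intro x hx
    obtain ⟨y, rfl⟩ := Ideal.Quotient.mk_surjective x
    rw [LinearMap.mem_ker, AlgHom.toLinearMap_apply, Ideal.Quotient.factorₐ_apply_mk,
      Ideal.Quotient.eq_zero_iff_mem, Ideal.mem_span_singleton'] at hx
    obtain ⟨z, rfl⟩ := hx
    change Ideal.Quotient.mk (Ideal.span {L}) (c • (z * L₀)) = 0
    rw [Ideal.Quotient.eq_zero_iff_mem, smul_eq_C_mul, Ideal.mem_span_singleton']
    exact ⟨z, by rw [hfac]; ring⟩
  -- `c` is a unit of `K` (it is non-zero in `𝒪_E ↪ K`)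
  have hcK : IsUnit (algebraMap (PadicIntermediateField.unitBall p E) K c) := by
    rw [isUnit_iff_ne_zero]
    intro h0
    apply hc0
    apply hK
    rw [h0, map_zero]
  rw [finrank_baseChange_eq_of_surjective_of_smul_ker_eq_zero K π.toLinearMap hπ c hcK hker,
    Module.finrank_baseChange, hrank]

end UnitBall

/-! ### §2. W-d on the crux's carriers: `lamO S (Λ_𝒪 ⧸ (Lm)) = d` -/

section CruxCurrency

open Literature.NumberTheory.Automorphic Literature.NumberTheory.EllipticCurves PowerSeries
open Literature.NumberTheory.EllipticCurves.GreenbergSelmer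

variable (p : ℕ) [Fact p.Prime] (S : Set (PadicAlgCl p)) [FiniteDimensional ℚ_[p] (padicCoeffField S)]

/-- **(W-d) in `λ_𝒪`-currency.** For `Lm ∈ Λ_𝒪 = IwasawaAlgebraO S`, `Lm ≠ 0`, and `d` with exactly RSL_g's / S3″'s norm binders on
`iwasawaOToPowerSeries S Lm` (`‖coeff k‖ ≤ ‖coeff d‖` for all `k`, `<` for `k < d`): `lamO S (Λ_𝒪 ⧸ (Lm)) = d` — the `hd` station of the KZ_g
node `ThetaTransport.S3BodyOfStations.s3body_sameClass_of_stations` (§1 with `K := FractionRing 𝒪`, transported along `padicCoeffIntegers_eq_unitBall`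
exactly as the landed `finrank_quotientTorsion_quotient_span_eq_of_normLambda_iwasawaAlgebraO`). [cite: Washington1997, §7.1 Thm. 7.3 and §13.2]
[cite: Kato2004Asterisque, §13.8 (p. 228)] -/
theorem lamO_quotient_span_eq_of_normLambda_iwasawaAlgebraO :
    ∀ (Lm : IwasawaAlgebraO S) (d : ℕ), Lm ≠ 0 →
      (∀ k : ℕ, ‖coeff k (iwasawaOToPowerSeries S Lm)‖ ≤ ‖coeff d (iwasawaOToPowerSeries S Lm)‖) →
      (∀ k : ℕ, k < d → ‖coeff k (iwasawaOToPowerSeries S Lm)‖ < ‖coeff d (iwasawaOToPowerSeries S Lm)‖) →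
      OnePair.lamO S (IwasawaAlgebraO S ⧸ Ideal.span {Lm}) = d := by
  simp only [OnePair.lamO_eq, coeff_iwasawaOToPowerSeries]
  unfold IwasawaAlgebraO
  rw [padicCoeffIntegers_eq_unitBall S]
  intro Lm d hL hle hlt
  exact finrank_baseChange_quotient_span_eq_of_normLambda_field p (padicCoeffField S) _
    (IsFractionRing.injective _ _) Lm d hL hle hlt

end CruxCurrency

end Summit.BirchSwinnertonDyer.BirchSwinnertonDyer.Theorems.LambdaLowerBoundO

end
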